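import Summits.BirchSwinnertonDyer.BirchSwinnertonDyer.Theorems.SignedLowerHalvesSprungLowerDivisibilityAtThreeKatoFineLowerPartial
import Summits.BirchSwinnertonDyer.BirchSwinnertonDyer.Theorems.SignedLowerHalvesSprungLowerDivisibilityAtThreeKatoFineLowerIff
import Summits.BirchSwinnertonDyer.Rank1Residual.X1.MuLambdaAlgebra
import Literature.NumberTheory.EllipticCurves.IwasawaAlgebraInvolutionFixedPrimesProofs
import HarnessLib

/-!
# Sketch — stub-ideation k4 (assume-the-opposite) for `stub_katoFineLowerSporadic` (crux stmt-BirchSwinnertonDyer-19875)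

Helper-lemma SIGNATURES only (all `sorry`); they must elaborate. Nothing here proves K_spor, K1, leaf X8 or BSD.
Plans: A (μ-free λ-budget door), B (cokernel-of-localisation classes: half-content criterion, Kurihara–Pollack /
Wingberg / Lei–Sujatha exact sequences read in the Eisenstein direction), C (rank-one leading-coefficient squeeze).
-/

set_option linter.dupNamespace false
set_option autoImplicit false

noncomputable section

open scoped Classical NumberField MatrixGroups ModularForm

open NumberField IsDedekindDomain CongruenceSubgroup WeierstrassCurve Field
  Literature.NumberTheory.EllipticCurves Literature.NumberTheory.EllipticCurves.ModularForms
  Literature.NumberTheory.EllipticCurves.ZpExtension Literature.NumberTheory.EllipticCurves.Sprung2017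
  Literature.NumberTheory.EllipticCurves.Sprung2012 Literature.NumberTheory.EllipticCurves.Rank1Residual
  Literature.NumberTheory.EllipticCurves.IwasawaAlgebra Literature.NumberTheory.EllipticCurves.Kato2004
  Literature.NumberTheory.EllipticCurves.Module
  Summit.BirchSwinnertonDyer.BirchSwinnertonDyer.Theorems
  Summit.BirchSwinnertonDyer.BirchSwinnertonDyer.Theorems.SmallImageSignedMuDefect
  Summit.BirchSwinnertonDyer.Rank1Residual.Supersingular

namespace Summit.BirchSwinnertonDyer.BirchSwinnertonDyer.Cruxes.SprungLowerDivisibilityAtThree.KatoFineSporadicK4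

open Summit.BirchSwinnertonDyer.Rank1Residual.X1 (MuLambda.lam MuLambda.mu)

/-! ## §0 Pure Λ-algebra helpers (no arithmetic) -/

/-- **H-A1 (Plan A, size S).** `g ∣ pⁿ·G`, `G ≠ 0`, `λ(G) ≤ λ(g)` ⟹ `Λ/(G)` and `Λ/(g)` have the same length at every
height-one prime not containing `p` (the cofactor has `λ = 0`, hence is `p^μ · unit`). μ-FREE form of the
Greenberg–Vatsal λ/μ criterion (`span_eq_span_iff_mu_le_and_lam_le`). -/
theorem lengthAt_quotient_span_eq_of_dvd_C_pow_mul_of_lam_le {p : ℕ} [Fact p.Prime]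
    {G g : IwasawaAlgebra p} (n : ℕ) (hG0 : G ≠ 0)
    (hdvd : g ∣ PowerSeries.C ((p : ℤ_[p]) ^ n) * G) (hlam : MuLambda.lam G ≤ MuLambda.lam g)
    (𝔭 : PrimeSpectrum (IwasawaAlgebra p)) (h𝔭 : 𝔭.asIdeal.height = 1)
    (hp𝔭 : (p : IwasawaAlgebra p) ∉ 𝔭.asIdeal) :
    Module.lengthAt (IwasawaAlgebra p) (IwasawaAlgebra p ⧸ Ideal.span {G}) 𝔭 =
      Module.lengthAt (IwasawaAlgebra p) (IwasawaAlgebra p ⧸ Ideal.span {g}) 𝔭 := by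
  sorry

/-- **H-B1 (Plan B, size S).** At a height-one prime `𝔭` of `Λ` (so `Λ_𝔭` is a DVR) the ideal `(a, b)` localises to
`𝔭^{min(ord a, ord b)}`: `ℓ_𝔭 Λ/(a,b) = min (ℓ_𝔭 Λ/(a)) (ℓ_𝔭 Λ/(b))`. -/
theorem lengthAt_quotient_span_pair_eq_min {p : ℕ} [Fact p.Prime] (a b : IwasawaAlgebra p)
    (ha : a ≠ 0) (hb : b ≠ 0) (𝔭 : PrimeSpectrum (IwasawaAlgebra p)) (h𝔭 : 𝔭.asIdeal.height = 1) :
    Module.lengthAt (IwasawaAlgebra p) (IwasawaAlgebra p ⧸ Ideal.span ({a, b} : Set (IwasawaAlgebra p))) 𝔭 =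
      min (Module.lengthAt (IwasawaAlgebra p) (IwasawaAlgebra p ⧸ Ideal.span {a}) 𝔭)
        (Module.lengthAt (IwasawaAlgebra p) (IwasawaAlgebra p ⧸ Ideal.span {b}) 𝔭) := by
  sorry

/-- **H-C1 (Plan C, size S).** Unit cofactor from ONE coefficient: if `pⁿ·G = g·h`, `g ≠ 0` has `T`-order `r`, and the
`r`-th coefficients of `pⁿ·G` and `g` have the same `p`-adic norm, then `h(0)` is a unit, hence `h` is a unit
(`PowerSeries.isUnit_iff_constantCoeff`), hence `(pⁿ·G) = (g)`. -/
theorem isUnit_cofactor_of_norm_coeff_order_eq {p : ℕ} [Fact p.Prime] {G g h : IwasawaAlgebra p} (n r : ℕ)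
    (hfac : PowerSeries.C ((p : ℤ_[p]) ^ n) * G = g * h) (hg0 : g ≠ 0) (hr : g.order = r)
    (hval : ‖(PowerSeries.coeff r (PowerSeries.C ((p : ℤ_[p]) ^ n) * G) : ℤ_[p])‖ =
      ‖(PowerSeries.coeff r g : ℤ_[p])‖) :
    IsUnit h := by
  sorry

/-! ## §1 The K_spor telescope (binders copied from the stub; `p` general, `ClassX8 W p` forces `p = 3`) -/

section Telescope

variable (W : WeierstrassCurve ℚ) [W.IsElliptic] [W.IsGloballyMinimal] (p : ℕ) [Fact p.Prime]
  [ContinuousSMul ℤ_[p] (W.tateModule p)] [Module.Free ℤ_[p] (W.tateModule p)] [Module.Finite ℤ_[p] (W.tateModule p)]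
  (hX : ClassX8 W p) {κ : ZpExtension ℚ p} {γ : Field.absoluteGaloisGroup ℚ}
  (hκ : κ.IsCyclotomic) (hγ : κ.IsTopGenerator γ) (hcv : IsCyclotomicVariable p γ)
  {v : HeightOneSpectrum (𝓞 ℚ)} (hv : (p : 𝓞 ℚ) ∈ v.asIdeal)
  {g : Field.absoluteGaloisGroup (v.adicCompletion ℚ)}
  (hg : κ.IsTopGenerator (resGalOfEmb (closureEmb (K := ℚ) (v.adicCompletion ℚ)) g))
  {cneg : localPoints W (v.adicCompletion ℚ)} {c : ℕ → localPoints W (v.adicCompletion ℚ)}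
  (hH : IsHondaSystem κ (closureEmb (K := ℚ) (v.adicCompletion ℚ)) W (W.frobeniusTrace p) g cneg c)
  {N : ℕ} [NeZero N] {f : CuspForm (Gamma0 N) 2} {ϖ : ℚ} {Lsharp Lflat : IwasawaAlgebra p}
  (hf : IsNewformOf W f) (hϖ : (ϖ : ℝ) * W.realPeriodRat = plusPeriod f)
  (hSP : IsSprungPair f p (W.frobeniusTrace p) Lsharp Lflat)
  {I : Kato2004.IwasawaH1Data W p κ γ}
  (Cs : SharpFlatColemanKatoData W p f ϖ κ γ (closureEmb (K := ℚ) (v.adicCompletion ℚ)) (W.frobeniusTrace p) g c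
    Chroma.sharp I)
  (Cf : SharpFlatColemanKatoData W p f ϖ κ γ (closureEmb (K := ℚ) (v.adicCompletion ℚ)) (W.frobeniusTrace p) g c
    Chroma.flat I)
  (hZ : Cs.Z = Cf.Z)

include hX hκ hγ hcv hv hg hH hf hϖ hSP hZ

/-- **H-A2 (Plan A door, size M): KFL off `(p)` from a λ-BUDGET for ONE non-zero colour.** If for some colour `•` with
`L^• ≠ 0` the Néron-normalised `G^•` has `λ(G^•) ≤ λ(char X^•)` for the (f.g. torsion, Thm 7.14) dual data of
`Sel^•(E/ℚ_∞)` («λ_alg ≥ λ_an», the converse of what Kato's divisibility gives), then Kato's fine lower bound holds at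
EVERY height-one `𝔭 ∌ p` — sporadic, positive-level cyclotomic and `(T)` at once. Proof route: Thm 7.16 ⟹ `gen ∣ pⁿ G`
(`ϖ ∈ ℤ_3^×` by `h3`); H-A1; `ℓ_𝔭 X^• = ℓ_𝔭 Λ/(gen)`; `eisenstein_iff_fine`; move to `Cs.Z` by `hZ`. -/
theorem katoFineLower_offP_of_lam_le (h714 : thm714_sharpFlatSelmerDual_finite_torsion)
    (h716 : thm716_sharpFlatCharIdeal_divisibility) (h3 : realPeriodRat_eq_unit_mul_plusPeriod_three)
    (hlam : ∃ col : Chroma, chromaticL col Lsharp Lflat ≠ 0 ∧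
      ∀ (G : IwasawaAlgebra p),
        iwasawaToPowerSeries p G = PowerSeries.C (ϖ : ℚ_[p]) * iwasawaToPowerSeries p (chromaticL col Lsharp Lflat) →
      ∀ (D : SharpFlatSelmerDualData W κ γ (closureEmb (K := ℚ) (v.adicCompletion ℚ)) (W.frobeniusTrace p) g c col)
        [Module.Finite (IwasawaAlgebra p) D.X], Module.IsTorsion (IwasawaAlgebra p) D.X →
      ∀ (gen : IwasawaAlgebra p), Module.charIdeal (IwasawaAlgebra p) D.X = Ideal.span {gen} →
        MuLambda.lam G ≤ MuLambda.lam gen)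
    (Y : W.FineSelmerDualData κ γ) (𝔭 : PrimeSpectrum (IwasawaAlgebra p)) (h𝔭 : 𝔭.asIdeal.height = 1)
    (hp𝔭 : (p : IwasawaAlgebra p) ∉ 𝔭.asIdeal) :
    Module.lengthAt (IwasawaAlgebra p) (I.H ⧸ Cs.Z) 𝔭 ≤ Module.lengthAt (IwasawaAlgebra p) Y.X 𝔭 := by
  sorry

/-- **H-B4 (Plan B, size M): the CONTENT IDENTITY at a height-one prime.** For a generator `c₀` of the pinned `𝐇¹`
(cyclic: Kato Thm 12.4 (3), `E[p]` irreducible on X8) and the Néron-normalised `Gs, Gf` of the two colours: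
`ℓ_𝔭 Λ/(Gs, Gf) = ℓ_𝔭(𝐇¹/Z) + ℓ_𝔭 Λ/(Col♯c₀, Col♭c₀)` — «common-zero multiplicity = zeta index + Coleman content».
From `image_zeta_localized` for both packages (same `Z` by `hZ`), cyclicity and H-B1. -/
theorem lengthAt_quotient_span_pair_normalised_eq_add (Gs Gf : IwasawaAlgebra p)
    (hGs : iwasawaToPowerSeries p Gs = PowerSeries.C (ϖ : ℚ_[p]) * iwasawaToPowerSeries p (chromaticL Chroma.sharp Lsharp Lflat))
    (hGf : iwasawaToPowerSeries p Gf = PowerSeries.C (ϖ : ℚ_[p]) * iwasawaToPowerSeries p (chromaticL Chroma.flat Lsharp Lflat))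
    (c₀ : I.H) (hc₀ : Submodule.span (IwasawaAlgebra p) {c₀} = ⊤)
    (𝔭 : PrimeSpectrum (IwasawaAlgebra p)) (h𝔭 : 𝔭.asIdeal.height = 1) :
    Module.lengthAt (IwasawaAlgebra p) (IwasawaAlgebra p ⧸ Ideal.span ({Gs, Gf} : Set (IwasawaAlgebra p))) 𝔭 =
      Module.lengthAt (IwasawaAlgebra p) (I.H ⧸ Cs.Z) 𝔭 +
        Module.lengthAt (IwasawaAlgebra p)
          (IwasawaAlgebra p ⧸ Ideal.span ({Cs.colMap c₀, Cf.colMap c₀} : Set (IwasawaAlgebra p))) 𝔭 := by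
  sorry

/-- **H-B3 (Plan B door, size M given H-B4): K_spor on an ι-ORBIT `{𝔭, ι𝔭}` of sporadic primes from the COKERNEL
BOUND and the HALF-CONTENT inequality.** `hWKP•` = «cokernel-of-localisation classes at `𝔭` are fine classes at `ι𝔭`»
(Wingberg 1989 Cor 2.5 = Matar 2020 Thm 1.1 `T_Λ(X_{p^∞})^ι ∼ X₀`, + Poitou–Tate, + the joint Coleman sequence
`0 → 𝐇¹_loc → Λ² → ℤ_p → 0`; Kurihara–Pollack 2007 Prop 3.4 (proof), Lei–Sujatha 2021 Prop 3.1), displayed as hypotheses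
to be typed as ONE named fact; `hKato•` = Kato Thm 13.4 (2) at the two primes (typed fact, displayed); `hhalf•` = «the zeta
index takes at most half of the common zero». Conclusion: Kato's fine lower bound at BOTH primes of the orbit. -/
theorem katoFineLowerAt_orbit_of_cokernelBound_of_halfContent (Gs Gf : IwasawaAlgebra p)
    (hGs : iwasawaToPowerSeries p Gs = PowerSeries.C (ϖ : ℚ_[p]) * iwasawaToPowerSeries p (chromaticL Chroma.sharp Lsharp Lflat))
    (hGf : iwasawaToPowerSeries p Gf = PowerSeries.C (ϖ : ℚ_[p]) * iwasawaToPowerSeries p (chromaticL Chroma.flat Lsharp Lflat))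
    (c₀ : I.H) (hc₀ : Submodule.span (IwasawaAlgebra p) {c₀} = ⊤)
    (Y : W.FineSelmerDualData κ γ) (𝔭 𝔮 : PrimeSpectrum (IwasawaAlgebra p)) (h𝔭 : 𝔭.asIdeal.height = 1)
    (h𝔮 : 𝔮 = PrimeSpectrum.comap (invol p).toRingHom 𝔭) (h𝔮1 : 𝔮.asIdeal.height = 1)
    (hp𝔭 : (p : IwasawaAlgebra p) ∉ 𝔭.asIdeal)
    (hT𝔭 : ¬ ∃ n : ℕ, ((cyclotomicOmega p n).map (Int.castRingHom ℤ_[p]) : PowerSeries ℤ_[p]) ∈ 𝔭.asIdeal)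
    (hWKP𝔭 : Module.lengthAt (IwasawaAlgebra p)
        (IwasawaAlgebra p ⧸ Ideal.span ({Cs.colMap c₀, Cf.colMap c₀} : Set (IwasawaAlgebra p))) 𝔭 ≤
      Module.lengthAt (IwasawaAlgebra p) Y.X 𝔮)
    (hWKP𝔮 : Module.lengthAt (IwasawaAlgebra p)
        (IwasawaAlgebra p ⧸ Ideal.span ({Cs.colMap c₀, Cf.colMap c₀} : Set (IwasawaAlgebra p))) 𝔮 ≤
      Module.lengthAt (IwasawaAlgebra p) Y.X 𝔭)
    (hKato𝔭 : Module.lengthAt (IwasawaAlgebra p) Y.X 𝔭 ≤ Module.lengthAt (IwasawaAlgebra p) (I.H ⧸ Cs.Z) 𝔭)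
    (hKato𝔮 : Module.lengthAt (IwasawaAlgebra p) Y.X 𝔮 ≤ Module.lengthAt (IwasawaAlgebra p) (I.H ⧸ Cs.Z) 𝔮)
    (hhalf𝔭 : 2 * Module.lengthAt (IwasawaAlgebra p) (I.H ⧸ Cs.Z) 𝔭 ≤
      Module.lengthAt (IwasawaAlgebra p) (IwasawaAlgebra p ⧸ Ideal.span ({Gs, Gf} : Set (IwasawaAlgebra p))) 𝔭)
    (hhalf𝔮 : 2 * Module.lengthAt (IwasawaAlgebra p) (I.H ⧸ Cs.Z) 𝔮 ≤
      Module.lengthAt (IwasawaAlgebra p) (IwasawaAlgebra p ⧸ Ideal.span ({Gs, Gf} : Set (IwasawaAlgebra p))) 𝔮) :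
    Module.lengthAt (IwasawaAlgebra p) (I.H ⧸ Cs.Z) 𝔭 ≤ Module.lengthAt (IwasawaAlgebra p) Y.X 𝔭 ∧
      Module.lengthAt (IwasawaAlgebra p) (I.H ⧸ Cs.Z) 𝔮 ≤ Module.lengthAt (IwasawaAlgebra p) Y.X 𝔮 := by
  sorry

/-- **H-B5 (Plan B by-product, size S given H-B4): «no sporadic common zero is invisible to Kato's zeta index».**
Under the cokernel bound at `𝔭` and Kato's UPPER bound (Thm 13.4 (2), typed fact, displayed) at `ι𝔭`: the common-zero
multiplicity `m = ℓ_𝔭 Λ/(G♯, G♭)` is at most the zeta index summed over the orbit, `m ≤ ℓ_𝔭(𝐇¹/Z) + ℓ_{ι𝔭}(𝐇¹/Z)`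
(self-conjugate `𝔭`: `m ≤ 2·ℓ_𝔭(𝐇¹/Z)`). This is the assume-the-opposite NORMAL FORM: K_spor can fail on the orbit only
inside the window `m ≤ x + x'`, `min(x, x') < m/2`… with `x = ℓ_𝔭(𝐇¹/Z)`, `x' = ℓ_{ι𝔭}(𝐇¹/Z)`; in particular `x + x' ≥ 1`. -/
theorem lengthAt_quotient_span_pair_le_orbit_sum_of_cokernelBound_of_kato (Gs Gf : IwasawaAlgebra p)
    (hGs : iwasawaToPowerSeries p Gs = PowerSeries.C (ϖ : ℚ_[p]) * iwasawaToPowerSeries p (chromaticL Chroma.sharp Lsharp Lflat))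
    (hGf : iwasawaToPowerSeries p Gf = PowerSeries.C (ϖ : ℚ_[p]) * iwasawaToPowerSeries p (chromaticL Chroma.flat Lsharp Lflat))
    (c₀ : I.H) (hc₀ : Submodule.span (IwasawaAlgebra p) {c₀} = ⊤)
    (Y : W.FineSelmerDualData κ γ) (𝔭 𝔮 : PrimeSpectrum (IwasawaAlgebra p)) (h𝔭 : 𝔭.asIdeal.height = 1)
    (h𝔮 : 𝔮 = PrimeSpectrum.comap (invol p).toRingHom 𝔭) (h𝔮1 : 𝔮.asIdeal.height = 1)
    (hWKP𝔭 : Module.lengthAt (IwasawaAlgebra p)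
        (IwasawaAlgebra p ⧸ Ideal.span ({Cs.colMap c₀, Cf.colMap c₀} : Set (IwasawaAlgebra p))) 𝔭 ≤
      Module.lengthAt (IwasawaAlgebra p) Y.X 𝔮)
    (hKato𝔮 : Module.lengthAt (IwasawaAlgebra p) Y.X 𝔮 ≤ Module.lengthAt (IwasawaAlgebra p) (I.H ⧸ Cs.Z) 𝔮) :
    Module.lengthAt (IwasawaAlgebra p) (IwasawaAlgebra p ⧸ Ideal.span ({Gs, Gf} : Set (IwasawaAlgebra p))) 𝔭 ≤
      Module.lengthAt (IwasawaAlgebra p) (I.H ⧸ Cs.Z) 𝔭 + Module.lengthAt (IwasawaAlgebra p) (I.H ⧸ Cs.Z) 𝔮 := by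
  sorry

/-- **H-B6 (Plan B, size S/M): the common-zero multiplicity is ι-SYMMETRIC off `(p)`** — `ℓ_𝔭 Λ/(G♯,G♭) = ℓ_{ι𝔭} Λ/(G♯,G♭)`:
the ideal `(L♯, L♭)` is `ι`-stable (tree `ClassX8.subst_invOnePlusSubOne_mem_of_mem`, p634976) and `(G♯,G♭)` differs
from it by the `p`-power content of `ϖ` only. Used inside H-B3. -/
theorem lengthAt_quotient_span_pair_normalised_comap_invol (Gs Gf : IwasawaAlgebra p)
    (hGs : iwasawaToPowerSeries p Gs = PowerSeries.C (ϖ : ℚ_[p]) * iwasawaToPowerSeries p (chromaticL Chroma.sharp Lsharp Lflat))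
    (hGf : iwasawaToPowerSeries p Gf = PowerSeries.C (ϖ : ℚ_[p]) * iwasawaToPowerSeries p (chromaticL Chroma.flat Lsharp Lflat))
    (𝔭 𝔮 : PrimeSpectrum (IwasawaAlgebra p)) (h𝔭 : 𝔭.asIdeal.height = 1)
    (h𝔮 : 𝔮 = PrimeSpectrum.comap (invol p).toRingHom 𝔭) (hp𝔭 : (p : IwasawaAlgebra p) ∉ 𝔭.asIdeal) :
    Module.lengthAt (IwasawaAlgebra p) (IwasawaAlgebra p ⧸ Ideal.span ({Gs, Gf} : Set (IwasawaAlgebra p))) 𝔭 =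
      Module.lengthAt (IwasawaAlgebra p) (IwasawaAlgebra p ⧸ Ideal.span ({Gs, Gf} : Set (IwasawaAlgebra p))) 𝔮 := by
  sorry

/-- **H-C2 (Plan C door, size M, rank one): leading-coefficient squeeze for ONE non-zero colour closes KFL at EVERY
height-one `𝔭 ∌ p` (sporadic included).** Inputs displayed: a generator `gen` of `char X^•` dividing `pⁿ G^•` (Thm 7.16),
with the same `T`-order as `G^•` (rank one: control + GZK + Kobayashi's simple zero) and the same norm of the leading
coefficient (p-adic BSD leading term in rank one: Perrin-Riou-type algebraic formula vs Kobayashi 2013 p-adic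
Gross–Zagier; the ♯/♭ height cancels). Then H-C1 ⟹ `(gen) = (pⁿ G^•)` ⟹ `ℓ_𝔭 Λ/(G^•) = ℓ_𝔭 X^•` off `(p)` ⟹ KFL. -/
theorem katoFineLower_offP_of_leadingCoeff (h714 : thm714_sharpFlatSelmerDual_finite_torsion)
    (col : Chroma) (hcol : chromaticL col Lsharp Lflat ≠ 0) (G gen : IwasawaAlgebra p) (n r : ℕ)
    (hG : iwasawaToPowerSeries p G = PowerSeries.C (ϖ : ℚ_[p]) * iwasawaToPowerSeries p (chromaticL col Lsharp Lflat))
    (D : SharpFlatSelmerDualData W κ γ (closureEmb (K := ℚ) (v.adicCompletion ℚ)) (W.frobeniusTrace p) g c col)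
    [Module.Finite (IwasawaAlgebra p) D.X] (hXt : Module.IsTorsion (IwasawaAlgebra p) D.X)
    (hchar : Module.charIdeal (IwasawaAlgebra p) D.X = Ideal.span {gen})
    (hdvd : gen ∣ PowerSeries.C ((p : ℤ_[p]) ^ n) * G) (hr : gen.order = r) (hrG : G.order = r)
    (hval : ‖(PowerSeries.coeff r (PowerSeries.C ((p : ℤ_[p]) ^ n) * G) : ℤ_[p])‖ =
      ‖(PowerSeries.coeff r gen : ℤ_[p])‖)
    (Y : W.FineSelmerDualData κ γ) (𝔭 : PrimeSpectrum (IwasawaAlgebra p)) (h𝔭 : 𝔭.asIdeal.height = 1)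
    (hp𝔭 : (p : IwasawaAlgebra p) ∉ 𝔭.asIdeal) :
    Module.lengthAt (IwasawaAlgebra p) (I.H ⧸ Cs.Z) 𝔭 ≤ Module.lengthAt (IwasawaAlgebra p) Y.X 𝔭 := by
  sorry

end Telescope

end Summit.BirchSwinnertonDyer.BirchSwinnertonDyer.Cruxes.SprungLowerDivisibilityAtThree.KatoFineSporadicK4
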